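import Literature.Analysis.Calculus.JacobianNullLagrangian
import Literature.Analysis.FunctionSpaces.TorusEnstrophyOrthogonality

/-!
# Piola's identity on the flat torus: the columns of the adjugate Jacobian of `y ↦ y + proj (D y)` are divergence free

Topic `Literature/Analysis/FunctionSpaces` (torus calculus), sequel of `Literature/Analysis/Calculus/JacobianNullLagrangian.lean`
(`Literature.Analysis.Calculus.sum_fderiv_jacCofactor_eq_zero`: for a `C²` map `f : ℝⁿ → ℝⁿ`, `Σⱼ ∂ⱼ (adj J)ⱼᵢ = 0`, Evans *PDE* §8.1.4.b).
For a smooth displacement `D : 𝕋ᵈ → ℝᵈ` the torus self-map `X y = y + proj (D y)` has Jacobian matrix `J(y)_{ac} = δ_{ac} + ∂_c D_a (y)`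
(a smooth, lattice-periodic matrix field), and

* `Torus.isDivFree_adjugate_col` — for every `i`, the `i`-th COLUMN `y ↦ ((adj J(y))_{c i})_c` of the adjugate is divergence free on the
  torus: `Σ_c ∂_c (adj J)_{c i} = 0` (`Torus.IsDivFree`).

This is the «Piola» input of the distorted passive-vector class (`Torus.IsWeakTensorPassiveVectorDistortedOn`: the distortion `G = (∇X)⁻¹
= adj ∇X` of a volume-preserving flow has divergence-free columns, so that `div (G·) = 0` is a conservation form).  Proof: transport to
`ℝᵈ = (d → ℝ)` through the lift `z ↦ z + D (proj z)` and the `WithLp` coordinates, identify the torus partial derivatives of the adjugate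
entries with the Euclidean ones of the cofactors `jacCofactor`, and apply the landed identity.  Mathlib has no Piola identity; the tree's is
the `ℝⁿ` one cited above.  No `sorry`.

References: L. C. Evans, *Partial Differential Equations*, 2nd ed. (2010), §8.1.4.b, Lemma (divergence-free rows of `cof Du`). [Evans2010]
-/

noncomputable section

open Function WithLp

namespace Literature.Analysis.FunctionSpaces.Torus

open Literature.Analysis.Calculus

variable {d : Type*} [Fintype d] [DecidableEq d]

omit [DecidableEq d] in
/-- The coordinate map is `C²` (indeed smooth). [folklore] -/
private theorem contDiff_liftMapCoord {D : UnitAddTorus d → EuclideanSpace ℝ d} (hD : IsSmooth D) :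
    ContDiff ℝ 2 (fun v : d → ℝ => v + ofLp (lift D (toLp 2 v))) := by
  have h2le : (2 : WithTop ℕ∞) ≤ ((⊤ : ℕ∞) : WithTop ℕ∞) := WithTop.coe_le_coe.mpr le_top
  have hD2 : ContDiff ℝ 2 (lift D) := hD.isContDiff (n := 2) h2le
  have h1 : ContDiff ℝ 2 (fun v : d → ℝ => ofLp (lift D (toLp 2 v))) :=
    (PiLp.continuousLinearEquiv 2 ℝ (fun _ : d => ℝ)).contDiff.comp
      (hD2.comp (PiLp.continuousLinearEquiv 2 ℝ (fun _ : d => ℝ)).symm.contDiff)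
  exact contDiff_id.add h1

omit [DecidableEq d] in
/-- The derivative of the coordinate map: `Df(v) w = w + ofLp (D(lift D)(toLp v) (toLp w))`. [folklore] -/
private theorem hasFDerivAt_liftMapCoord {D : UnitAddTorus d → EuclideanSpace ℝ d} (hD : IsSmooth D) (v : d → ℝ) :
    HasFDerivAt (fun v : d → ℝ => v + ofLp (lift D (toLp 2 v)))
      (ContinuousLinearMap.id ℝ (d → ℝ) +
        ((PiLp.continuousLinearEquiv 2 ℝ (fun _ : d => ℝ) : EuclideanSpace ℝ d →L[ℝ] (d → ℝ)).comp
          ((_root_.fderiv ℝ (lift D) (toLp 2 v)).comp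
            ((PiLp.continuousLinearEquiv 2 ℝ (fun _ : d => ℝ)).symm : (d → ℝ) →L[ℝ] EuclideanSpace ℝ d)))) v := by
  have hdiff : DifferentiableAt ℝ (lift D) (toLp 2 v) := (hD.differentiable (by simp)).differentiableAt
  have h2 : HasFDerivAt ((lift D) ∘ ⇑(PiLp.continuousLinearEquiv 2 ℝ (fun _ : d => ℝ)).symm)
      ((_root_.fderiv ℝ (lift D) (toLp 2 v)).comp
        ((PiLp.continuousLinearEquiv 2 ℝ (fun _ : d => ℝ)).symm : (d → ℝ) →L[ℝ] EuclideanSpace ℝ d)) v :=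
    hdiff.hasFDerivAt.comp v ((PiLp.continuousLinearEquiv 2 ℝ (fun _ : d => ℝ)).symm.hasFDerivAt)
  have h3 := ((PiLp.continuousLinearEquiv 2 ℝ (fun _ : d => ℝ)).hasFDerivAt).comp v h2
  exact (hasFDerivAt_id v).add h3

/-- **The Jacobian matrix of the coordinate map is `δ_{ac} + ∂_c D_a`** at `proj` of the point. [folklore] -/
private theorem jacobianMatrix_liftMapCoord {D : UnitAddTorus d → EuclideanSpace ℝ d} (hD : IsSmooth D)
    (z : EuclideanSpace ℝ d) (a c : d) :
    jacobianMatrix (fun v : d → ℝ => v + ofLp (lift D (toLp 2 v))) (ofLp z) a c = (1 : Matrix d d ℝ) a c + partialDeriv c (fun w => D w a) (proj z) := by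
  have h1 : IsContDiff 1 D := hD.isContDiff (by simp)
  rw [jacobianMatrix_apply, (hasFDerivAt_liftMapCoord hD (ofLp z)).fderiv]
  simp only [_root_.add_apply, ContinuousLinearMap.id_apply, ContinuousLinearMap.coe_comp, Function.comp_apply,
    Pi.add_apply, toLp_ofLp]
  rw [partialDeriv_apply_coord h1, partialDeriv_eq_fderiv_apply h1, ← fderiv_lift, Matrix.one_apply, Pi.single_apply]
  rfl

/-- **PIOLA'S IDENTITY ON THE TORUS.**  For a smooth displacement `D : 𝕋ᵈ → ℝᵈ`, every column of the adjugate of the Jacobian matrix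
`J(y)_{ac} = δ_{ac} + ∂_c D_a (y)` of the torus map `y ↦ y + proj (D y)` is divergence free: `Σ_c ∂_c (adj J)_{c i} = 0`.
[cite: Evans2010, §8.1.4.b Lemma (divergence-free rows of the cofactor matrix)] -/
theorem isDivFree_adjugate_col {D : UnitAddTorus d → EuclideanSpace ℝ d} (hD : IsSmooth D) (i : d) :
    IsDivFree (fun y => toLp 2 (fun c =>
      (Matrix.of fun a c' => (1 : Matrix d d ℝ) a c' + partialDeriv c' (fun w => D w a) y).adjugate c i)) := by
  intro y
  set f : (d → ℝ) → d → ℝ := (fun v : d → ℝ => v + ofLp (lift D (toLp 2 v))) with hf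
  have hfC : ContDiff ℝ 2 f := contDiff_liftMapCoord hD
  have hfC2 : ∀ v, ContDiffAt ℝ 2 f v := fun v => hfC.contDiffAt
  -- the adjugate entry `(c, i)` as a torus function, and its lift = the Euclidean cofactor `C_{ic}` read through `ofLp`
  have hlift : ∀ c : d, (lift fun y => (Matrix.of fun a c' => (1 : Matrix d d ℝ) a c' + partialDeriv c' (fun w => D w a) y).adjugate c i)
      = fun z => jacCofactor f i c (ofLp z) := by
    intro c
    funext z
    rw [lift_apply, jacCofactor_eq_adjugate]
    congr 1
    ext a c'
    rw [Matrix.of_apply, hf, jacobianMatrix_liftMapCoord hD z a c']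
  -- the torus partial derivative of the entry = the Euclidean partial derivative of the cofactor
  have hpd : ∀ c : d, partialDeriv c (fun y => (toLp 2 (fun c'' =>
        (Matrix.of fun a c' => (1 : Matrix d d ℝ) a c' + partialDeriv c' (fun w => D w a) y).adjugate c'' i) : EuclideanSpace ℝ d) c) y
      = _root_.fderiv ℝ (jacCofactor f i c) (ofLp (repr y)) (Pi.single c 1) := by
    intro c
    -- unfold the torus partial derivative as a line derivative of the lift at `repr y`
    have e1 : (fun y => (toLp 2 (fun c'' =>
        (Matrix.of fun a c' => (1 : Matrix d d ℝ) a c' + partialDeriv c' (fun w => D w a) y).adjugate c'' i) : EuclideanSpace ℝ d) c)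
        = fun y => (Matrix.of fun a c' => (1 : Matrix d d ℝ) a c' + partialDeriv c' (fun w => D w a) y).adjugate c i := by
      funext y'; rfl
    rw [e1]
    set g : UnitAddTorus d → ℝ := fun y => (Matrix.of fun a c' => (1 : Matrix d d ℝ) a c' + partialDeriv c' (fun w => D w a) y).adjugate c i
      with hg
    have hg_lift : lift g = fun z => jacCofactor f i c (ofLp z) := hlift c
    -- differentiability of the lift at `repr y`
    have hdiffE : HasFDerivAt (fun z : EuclideanSpace ℝ d => jacCofactor f i c (ofLp z))
        ((_root_.fderiv ℝ (jacCofactor f i c) (ofLp (repr y))).comp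
          (PiLp.continuousLinearEquiv 2 ℝ (fun _ : d => ℝ) : EuclideanSpace ℝ d →L[ℝ] (d → ℝ))) (repr y) := by
      have h := (hasFDerivAt_jacCofactor (hfC2 (ofLp (repr y))) i c).differentiableAt.hasFDerivAt
      exact h.comp (repr y) (PiLp.continuousLinearEquiv 2 ℝ (fun _ : d => ℝ)).hasFDerivAt
    have hline : partialDeriv c g y = _root_.lineDeriv ℝ (lift g) (repr y) (EuclideanSpace.single c (1 : ℝ)) := by
      rw [partialDeriv, lineDeriv_eq_lineDeriv_liftAt, ← proj_repr y, liftAt_proj, proj_repr]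
      simp only [_root_.lineDeriv, Function.comp_apply, zero_add]
    rw [hline, hg_lift, hdiffE.differentiableAt.lineDeriv_eq_fderiv, hdiffE.fderiv]
    simp [PiLp.coe_continuousLinearEquiv, PiLp.ofLp_single]
  -- sum over the columns: Piola in `ℝᵈ`
  unfold divergence
  simp_rw [hpd]
  exact sum_fderiv_jacCofactor_eq_zero (hfC2 (ofLp (repr y))) i

end Literature.Analysis.FunctionSpaces.Torus

end
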